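import Literature.AnabelianGeometry.AbsoluteAnabelian.HyperbolicCurveHyperbolicCore
import Literature.AnabelianGeometry.AbsoluteAnabelian.HyperbolicCoverOfNonabelianFundamentalGroupSecondCountable
import Literature.Geometry.Kaehler.RiemannSurfaceDipoleMoebiusRigidity
import HarnessLib

/-!
# [AbsTopIII] Cor. 2.4 (b)(c) at a general hyperbolic Riemann surface with non-abelian `π₁` — unconditionally

[cite: MochizukiAbsTopIII2015, Corollary 2.4 (b)(c) p.54–55] — «Let `X` be a hyperbolic Riemann surface
of finite type; `U^top → X^top` its universal covering … (b) a natural injection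
`π₁(X^top) = Aut(U^top/X^top) ↪ Aut⁰(𝕌) ⊆ Aut(𝕌)`; (c) if `X` is not arithmetic, the hyperbolic core … the
orbispace quotient of `U^top` by the commensurator `Π`».

`HyperbolicCurveHyperbolicCore` proved (b) and (c) for every connected Riemann surface of finite type with
NON-ABELIAN fundamental group, CONDITIONALLY on the named fact
`RiemannSurface.SimplyConnectedUniformization` (uniformization of simply connected Riemann surfaces,
Poincaré–Koebe 1907) and under the instance binder `SecondCountableTopology (UniversalCover X x₀)`.
Both binders are now theorems of the tree: `RiemannSurface.simplyConnectedUniformization_holds`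
(`RiemannSurfaceDipoleMoebiusRigidity`; alternative route to its parabolic third:
`RiemannSurfaceSemiAdmissibleBounded`) and `UniversalCover.secondCountableTopology_riemannSurface`.
This file records the UNCONDITIONAL statements:

* `exists_disc_covering_of_nonabelian_fundamentalGroup_holds` — Lin (7.6.2.1), case (3): a connected
  second countable Riemann surface with non-abelian `π₁` is holomorphically covered by the unit disc;
* `exists_deckGroup_subset_autIdComponent_of_nonabelian_fundamentalGroup_holds` — **Cor. 2.4 (b)**;
* `exists_hyperbolicCore_data_of_nonabelian_fundamentalGroup_holds` — **Cor. 2.4 (c)** (under the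
  printed non-arithmeticity hypothesis, typed `IsMargulisNonArithmetic`, a hypothesis on the deck group
  exactly as in print).

HONEST FRAMING: instantiation of the tree's theorems at genuine objects; classical inputs only; nothing here
bears on the disputed [IUTchIII] Cor. 3.12 (typed ≠ proved ≠ endorsed).  No new definitions, no named facts.
-/

noncomputable section

open Set Function Metric TopologicalSpace
open scoped Manifold ContDiff Topology

namespace Literature.AnabelianGeometry.AbsoluteAnabelian

open Literature.Topology.CoveringSpaces
open Literature.Geometry.Kaehler

variable (X : Type) [TopologicalSpace X] [T2Space X] [SecondCountableTopology X] [ConnectedSpace X]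
  [ChartedSpace ℂ X] [IsManifold 𝓘(ℂ, ℂ) ω X]

/-- **A connected second countable Riemann surface with non-abelian fundamental group is holomorphically
covered by the unit disc, unconditionally** (Lin (7.6.2.1), case (3) of the trichotomy by the universal
covering surface): the named fact `H2` of `exists_disc_covering_of_nonabelian_fundamentalGroup'`
discharged by `RiemannSurface.simplyConnectedUniformization_holds`.
[cite: Lin2011ClassicalComplexAnalysisII, §7.6.2 (7.6.2.1)] -/
theorem exists_disc_covering_of_nonabelian_fundamentalGroup_holds (x₀ : X)
    (hπ : ∃ a b : FundamentalGroup X x₀, a * b ≠ b * a) :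
    ∃ p : unitDiscOpens → X,
      IsCoveringMap p ∧ Function.Surjective p ∧ MDifferentiable 𝓘(ℂ, ℂ) 𝓘(ℂ, ℂ) p :=
  exists_disc_covering_of_nonabelian_fundamentalGroup' RiemannSurface.simplyConnectedUniformization_holds
    x₀ hπ

/-- **[AbsTopIII] Cor. 2.4 (b), unconditionally, at every connected second countable Riemann surface of
finite type with non-abelian fundamental group** (all hyperbolic curves of type `(g, r)`, `2g − 2 + r > 0`,
over `ℂ`): `X` has a surjective holomorphic universal covering `p : 𝔻 → X` by the unit disc and every deck
transformation of `p` lies in the identity component `Aut⁰(𝔻)` of the automorphism group of the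
Aut-holomorphic disc. [cite: MochizukiAbsTopIII2015, Corollary 2.4 (b) p.54] -/
theorem exists_deckGroup_subset_autIdComponent_of_nonabelian_fundamentalGroup_holds
    (hX : IsOfFiniteType X) (x₀ : X) (hπ : ∃ a b : FundamentalGroup X x₀, a * b ≠ b * a) :
    ∃ p : unitDiscOpens → X, IsCoveringMap p ∧ Function.Surjective p ∧
      MDifferentiable 𝓘(ℂ, ℂ) 𝓘(ℂ, ℂ) p ∧
      ((deckGroup p : Subgroup (unitDiscOpens ≃ₜ unitDiscOpens)) :
          Set (unitDiscOpens ≃ₜ unitDiscOpens)) ⊆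
        autIdComponent (AutHolStructure.ofCharted unitDiscOpens) := by
  haveI := Literature.Geometry.Kaehler.UniversalCover.secondCountableTopology_riemannSurface x₀
  exact exists_deckGroup_subset_autIdComponent_of_nonabelian_fundamentalGroup X
    RiemannSurface.simplyConnectedUniformization_holds hX x₀ hπ

/-- **[AbsTopIII] Cor. 2.4 (c), unconditionally (up to the printed non-arithmeticity hypothesis), at every
connected second countable Riemann surface of finite type with non-abelian fundamental group**: for the
holomorphic universal covering `p : 𝔻 → X`, the commensurator `Π` of `π₁(X) = Aut(𝔻/X)` in `Aut⁰(𝔻)`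
acts on `𝔻` properly discontinuously, with finite stabilisers, by automorphisms of the Aut-holomorphic
disc — the hyperbolic-core orbispace data. [cite: MochizukiAbsTopIII2015, Corollary 2.4 (c) p.55] -/
theorem exists_hyperbolicCore_data_of_nonabelian_fundamentalGroup_holds
    (hX : IsOfFiniteType X) (x₀ : X) (hπ : ∃ a b : FundamentalGroup X x₀, a * b ≠ b * a) :
    ∃ p : unitDiscOpens → X, IsCoveringMap p ∧ Function.Surjective p ∧
      MDifferentiable 𝓘(ℂ, ℂ) 𝓘(ℂ, ℂ) p ∧
      ∀ G : Subgroup (unitDiscOpens ≃ₜ unitDiscOpens),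
        (G : Set (unitDiscOpens ≃ₜ unitDiscOpens)) =
            autIdComponent (AutHolStructure.ofCharted unitDiscOpens) →
        IsMargulisNonArithmetic G (deckGroup p) →
        let Pc : Subgroup (unitDiscOpens ≃ₜ unitDiscOpens) :=
          (Subgroup.Commensurable.commensurator ((deckGroup p).subgroupOf G)).map G.subtype
        (∀ K L : Set unitDiscOpens, IsCompact K → IsCompact L →
            {γ : unitDiscOpens ≃ₜ unitDiscOpens | γ ∈ Pc ∧ (γ '' K ∩ L).Nonempty}.Finite) ∧
          (∀ x : unitDiscOpens, {γ : unitDiscOpens ≃ₜ unitDiscOpens | γ ∈ Pc ∧ γ x = x}.Finite) ∧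
          ((Pc : Set (unitDiscOpens ≃ₜ unitDiscOpens)) ⊆
            autSet (AutHolStructure.ofCharted unitDiscOpens)) := by
  haveI := Literature.Geometry.Kaehler.UniversalCover.secondCountableTopology_riemannSurface x₀
  exact exists_hyperbolicCore_data_of_nonabelian_fundamentalGroup X
    RiemannSurface.simplyConnectedUniformization_holds hX x₀ hπ

end Literature.AnabelianGeometry.AbsoluteAnabelian

end
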